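import Summits.QuantumFields.YangMills.Theorems.BalabanUVNodesN15TwoGridFirstOrderValueDefect
import Summits.QuantumFields.YangMills.Theorems.BalabanUVNodesN15TwoGridLandauEntry0Full
import HarnessLib

/-!
# N15 (NE2) — PROGRAMME M-II «THE FIRST-ORDER LAYER BY PARTS», part II-D: ★★★ HYPOTHESIS-FREE FOR BAŁABAN's FULL PAIR `(Δ′_a⁻¹, Δ_a⁻¹)` — the η-defect of the values of the
# first-order dressed pair is `≤ B·((L^k)^{−γ∕2} + o_a)·e^{−δd}` for EVERY fine coefficient family with `|c′|, |a′| ≤ r ≤ r₀`, `|∇′⁻a′| ≤ r_b ≤ r₀`, fit of `a′` `≤ o_a`; NOTHING on `∇c′`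

WHO ∕ WHEN.  Cell `pub-ymgap`, seat `pub-ymgap-dag-n15-a` (KNIT-BY-NAME seat of Track-A DAG node N15 = NE2, g24); `--kind proof --supports stmt-QuantumFields-27366 --as helper` (K3⁸;
count-neutral).  THEOREMS ONLY (0 `def`).  Over part II-C `…TwoGridFirstOrderValueDefect` (★★★ `hasMaj_idef_bgPairValue_of_letters`) and the tree's hypothesis-free `U ≡ 1` rows BY NAME:
part 3 `ineq110_114_pair` ((1.110) on both grids, from `B5Prop12GHolds.prop12_famG_printed`), `hasMaj_gOp_of_ineq` (values), `hasMaj_grad_of_ineq` (gradient rows `∇G`), N-IIn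
`hasMaj_gGrad_of_ineq` (source-gradient rows `G∇`), `hasMaj_gDivAdj_of_ineq` (source-divergence rows `G∇*`), part 52 `hasMaj_twoGridDefect` (the pair's own η-defect with the rate
`(L^k)^{−γ∕2}`), `rowSum_unitTorusGeo`; nothing in the tree is modified.

WHAT.  §20 `firstOrder_const_bound` (arithmetic).  §21 ★★★ `hasMaj_idef_bgPairValue_gOp`: for `d`, odd `L ≥ 3`, `a > 0`, `0 < γ < 1` there are `δ, r₀, B > 0` such that for EVERY volume exponent
`m_T`, coarse scale `k ≥ 1`, refinement `m`, every `0 ≤ r, r_b ≤ r₀`, `0 ≤ o_a`, and every fine first-order coefficient family `(c′, a′_μ)` on the `L^{−(m+k)}`-torus with `|c′|, |a′_μ| ≤ r`,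
`|L^{m+k}(a′_μ − a′_μ(· − e′_μ))| ≤ r_b`, `|a′_μ − blockAvg a′_μ ∘ π| ≤ o_a`: the η-defect of the VALUES of the first-order dressed propagators on Bałaban's `G′ = Δ′_a⁻¹`, `G = Δ_a⁻¹`
(fine perturbation `M_{c′} + Σ_μ M_{a′_μ}∇′_μ`, coarse partner the block averages) is `≤ B·((L^k)^{−γ∕2} + o_a)·e^{−δ|y−y′|_T}`.  The (3.35) reading: `r, r_b = O(1)Mα₀·(scale factors)` are
the printed smallness; `o_a ≤ 2(d+1)(L^m − 1)r_b′∕L^{m+k}` is one rate factor below the gradient letter (n15-c FILE 10 `fibreOsc_of_fgrad`, not consumed here); NO letter on `∇c′` or `∇∇a′`.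

HONEST FRAMING ∕ LIMITS.  Entry 0 (values) only; abelianised scalar-multiplier MODEL of (3.52)'s `V′(A)`; GENUINE in the propagators; NE2⁺ NOT printed ∕ proved; no statement of record
touched; N15 NOT discharged; K3⁸ OPEN; counts UNMOVED (typed 28∕28 · discharged 5∕27); NOT infinite volume ∕ OS ∕ mass gap ∕ Clay.
-/

noncomputable section

open scoped BigOperators
open Finset

namespace Summit.QuantumFields.YangMills.BalabanUVNodes.N15.TwoGrid

open Literature.MathematicalPhysics.QuantumFieldTheory.Balaban1983to89
open Literature.MathematicalPhysics.QuantumFieldTheory.Balaban1983to89.B11SectG (BlockNorm HasMaj RowSum)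
open Literature.MathematicalPhysics.QuantumFieldTheory.Balaban1983to89.T4EtaRateDefect (idef)
open Literature.MathematicalPhysics.QuantumFieldTheory.Balaban1983to89.T4EtaRateCoeffDefect (pull blockAvg)
open Literature.MathematicalPhysics.QuantumFieldTheory.Balaban1983to89.B5Prop11Plancherel (Tor fine unitVec)
open Literature.MathematicalPhysics.QuantumFieldTheory.Balaban1983to89.B5SiteBridgeP12 (MP)
open Literature.MathematicalPhysics.QuantumFieldTheory.King1986.Torus (blockOf tdistT tdistT_nonneg)
open Literature.MathematicalPhysics.QuantumFieldTheory.Balaban1983to89.B6UnitTorusCarrier (unitTorusGeo rowSum_unitTorusGeo)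
open Summit.QuantumFields.YangMills.BalabanUVNodes.N15.VectorPiece (blkFine kingPrV)
open Summit.QuantumFields.YangMills.BalabanUVNodes.N15.BackgroundLayer (bgPair projO)

variable {d : ℕ}

/-! ## §20 Constants bookkeeping -/

/-- the four summands of II-C's constant against `r, r_b ≤ r₀`, `x ≤ θ`, `(1 − q)⁻¹ ≤ 2` (both guards). [folklore] -/
theorem firstOrder_const_bound {D C C₂ cr r rb r₀ oa θ x t q₁ q₂ : ℝ} (hD : 0 ≤ D) (hC : 0 ≤ C) (hC₂ : 0 ≤ C₂) (hcr : 0 ≤ cr) (hr : 0 ≤ r) (hrr₀ : r ≤ r₀) (hrb : 0 ≤ rb)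
    (hrbr₀ : rb ≤ r₀) (hoa : 0 ≤ oa) (hθ : 0 ≤ θ) (hx : 0 ≤ x) (hxθ : x ≤ θ) (ht : 0 ≤ t) (hq₁ : 0 ≤ q₁) (hq₁2 : q₁ ≤ 2) (hq₂ : 0 ≤ q₂) (hq₂2 : q₂ ≤ 2) :
    (D * θ * (1 + r * (t + 2) * (C * q₁) * cr) + 2 * (t + 1) * r * x * C * (C * q₁) * cr + (t + 1) * ((C₂ * r + C * rb) * (x * (C * q₁)) * cr) + (t + 1) * (C * oa * (C * q₁) * cr)) * q₂
      ≤ (2 * (D * (1 + r₀ * (t + 2) * (2 * C) * cr) + 2 * (t + 1) * r₀ * C * (2 * C) * cr + (t + 1) * ((C₂ + C) * r₀ * (2 * C)) * cr) + 2 * ((t + 1) * (C * (2 * C)) * cr) + 1) *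
        (θ + oa) := by
  have hr₀ : 0 ≤ r₀ := hr.trans hrr₀
  have hP : C * q₁ ≤ 2 * C := by nlinarith
  have hP0 : 0 ≤ C * q₁ := mul_nonneg hC hq₁
  have hrP : r * (C * q₁) ≤ r₀ * (2 * C) := mul_le_mul hrr₀ hP hP0 hr₀
  have hbP : rb * (C * q₁) ≤ r₀ * (2 * C) := mul_le_mul hrbr₀ hP hP0 hr₀
  have s1 : D * θ * (1 + r * (t + 2) * (C * q₁) * cr) ≤ D * (1 + r₀ * (t + 2) * (2 * C) * cr) * θ := by
    have h : r * (t + 2) * (C * q₁) * cr ≤ r₀ * (t + 2) * (2 * C) * cr := by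
      calc r * (t + 2) * (C * q₁) * cr = (r * (C * q₁)) * ((t + 2) * cr) := by ring
        _ ≤ (r₀ * (2 * C)) * ((t + 2) * cr) := mul_le_mul_of_nonneg_right hrP (by positivity)
        _ = r₀ * (t + 2) * (2 * C) * cr := by ring
    calc D * θ * (1 + r * (t + 2) * (C * q₁) * cr) = (D * θ) * (1 + r * (t + 2) * (C * q₁) * cr) := by ring
      _ ≤ (D * θ) * (1 + r₀ * (t + 2) * (2 * C) * cr) := mul_le_mul_of_nonneg_left (by linarith) (by positivity)
      _ = D * (1 + r₀ * (t + 2) * (2 * C) * cr) * θ := by ring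
  have s2 : 2 * (t + 1) * r * x * C * (C * q₁) * cr ≤ 2 * (t + 1) * r₀ * C * (2 * C) * cr * θ := by
    calc 2 * (t + 1) * r * x * C * (C * q₁) * cr = (2 * (t + 1) * C * cr) * (r * (C * q₁)) * x := by ring
      _ ≤ (2 * (t + 1) * C * cr) * (r₀ * (2 * C)) * θ := mul_le_mul (mul_le_mul_of_nonneg_left hrP (by positivity)) hxθ hx (by positivity)
      _ = 2 * (t + 1) * r₀ * C * (2 * C) * cr * θ := by ring
  have s3 : (t + 1) * ((C₂ * r + C * rb) * (x * (C * q₁)) * cr) ≤ (t + 1) * ((C₂ + C) * r₀ * (2 * C)) * cr * θ := by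
    have h : (C₂ * r + C * rb) * (C * q₁) ≤ (C₂ + C) * r₀ * (2 * C) := by
      calc (C₂ * r + C * rb) * (C * q₁) = C₂ * (r * (C * q₁)) + C * (rb * (C * q₁)) := by ring
        _ ≤ C₂ * (r₀ * (2 * C)) + C * (r₀ * (2 * C)) := add_le_add (mul_le_mul_of_nonneg_left hrP hC₂) (mul_le_mul_of_nonneg_left hbP hC)
        _ = (C₂ + C) * r₀ * (2 * C) := by ring
    have h0 : 0 ≤ (C₂ * r + C * rb) * (C * q₁) := by positivity
    calc (t + 1) * ((C₂ * r + C * rb) * (x * (C * q₁)) * cr) = ((t + 1) * cr) * (((C₂ * r + C * rb) * (C * q₁)) * x) := by ring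
      _ ≤ ((t + 1) * cr) * (((C₂ + C) * r₀ * (2 * C)) * θ) := mul_le_mul_of_nonneg_left (mul_le_mul h hxθ hx (h0.trans h)) (by positivity)
      _ = (t + 1) * ((C₂ + C) * r₀ * (2 * C)) * cr * θ := by ring
  have s4 : (t + 1) * (C * oa * (C * q₁) * cr) ≤ (t + 1) * (C * (2 * C)) * cr * oa := by
    calc (t + 1) * (C * oa * (C * q₁) * cr) = ((t + 1) * C * cr * oa) * (C * q₁) := by ring
      _ ≤ ((t + 1) * C * cr * oa) * (2 * C) := mul_le_mul_of_nonneg_left hP (by positivity)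
      _ = (t + 1) * (C * (2 * C)) * cr * oa := by ring
  set E₁ : ℝ := D * (1 + r₀ * (t + 2) * (2 * C) * cr) + 2 * (t + 1) * r₀ * C * (2 * C) * cr + (t + 1) * ((C₂ + C) * r₀ * (2 * C)) * cr with hE₁
  set E₂ : ℝ := (t + 1) * (C * (2 * C)) * cr with hE₂
  have hE₁0 : 0 ≤ E₁ := by positivity
  have hE₂0 : 0 ≤ E₂ := by positivity
  have hA : D * θ * (1 + r * (t + 2) * (C * q₁) * cr) + 2 * (t + 1) * r * x * C * (C * q₁) * cr + (t + 1) * ((C₂ * r + C * rb) * (x * (C * q₁)) * cr) +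
      (t + 1) * (C * oa * (C * q₁) * cr) ≤ E₁ * θ + E₂ * oa := by rw [hE₁, hE₂]; nlinarith [s1, s2, s3, s4]
  have hA0 : 0 ≤ D * θ * (1 + r * (t + 2) * (C * q₁) * cr) + 2 * (t + 1) * r * x * C * (C * q₁) * cr + (t + 1) * ((C₂ * r + C * rb) * (x * (C * q₁)) * cr) +
      (t + 1) * (C * oa * (C * q₁) * cr) := by positivity
  calc _ ≤ (E₁ * θ + E₂ * oa) * 2 := mul_le_mul hA hq₂2 hq₂ (by positivity)
    _ ≤ (2 * E₁ + 2 * E₂ + 1) * (θ + oa) := by nlinarith [mul_nonneg hE₁0 hoa, mul_nonneg hE₂0 hθ]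

/-! ## §21 ★★★ Hypothesis-free for Bałaban's pair -/

section Balaban

variable (d)
set_option maxHeartbeats 400000 in
/-- ★★★ **THE BACKGROUND-LIVE FIRST-ORDER LAYER (VALUES), PRODUCED RATE, NO LETTER ON THE ZEROTH-ORDER COEFFICIENT BEYOND ITS SUP.**  See the module docstring (WHAT).  Letters of record:
(1.110) on both grids (`ineq110_114_pair` → `hasMaj_gOp_of_ineq`, `hasMaj_grad_of_ineq`, `hasMaj_gGrad_of_ineq`, `hasMaj_gDivAdj_of_ineq`), the pair's η-defect (`hasMaj_twoGridDefect`); II-C does the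
rest. [cite: Balaban1985BackgroundPropagators, (3.35) p.396, (3.52) p.400, (3.62)–(3.65) pp.402–403 (mechanism); Balaban1984PropagatorsI, Prop. 1.2 (1.110) p.35; King1986, Prop. 3.9 (3.73) p.665 (rate factor)] -/
theorem hasMaj_idef_bgPairValue_gOp {L : ℕ} [NeZero L] (hLodd : Odd L) (hL3 : 3 ≤ L) {a : ℝ} (ha : 0 < a) {γ : ℝ} (hγ0 : 0 < γ) (hγ1 : γ < 1) :
    ∃ δ r₀ B : ℝ, 0 < δ ∧ 0 < r₀ ∧ 0 < B ∧ ∀ (mT k m : ℕ) (hk : 1 ≤ k) (hL : Odd L ∧ 1 < L) (r : ℝ) (_hr : 0 ≤ r) (_hr₀ : r ≤ r₀) (rb : ℝ) (_hrb : 0 ≤ rb) (_hrb₀ : rb ≤ r₀)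
      (oa : ℝ) (_hoa : 0 ≤ oa)
      (c' : Tor (fine (L ^ m * L ^ k) (MP (paramsOf d L mT k hL))) × Fin (d + 1) → ℝ) (a' : Fin (d + 1) → Tor (fine (L ^ m * L ^ k) (MP (paramsOf d L mT k hL))) × Fin (d + 1) → ℝ)
      (_hc' : ∀ z, |c' z| ≤ r) (_ha' : ∀ μ z, |a' μ z| ≤ r)
      (_hb' : ∀ μ z, |((L ^ m * L ^ k : ℕ) : ℝ) * (a' μ z - a' μ (z.1 - unitVec (fine (L ^ m * L ^ k) (MP (paramsOf d L mT k hL))) μ, z.2))| ≤ rb)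
      (_hfa : ∀ μ z, |a' μ z - blockAvg (kingPrV L k m (MP (paramsOf d L mT k hL))) (a' μ) (kingPrV L k m (MP (paramsOf d L mT k hL)) z)| ≤ oa),
      HasMaj (BlockNorm.ofBlocks (unitTorusGeo L k (MP (paramsOf d L mT k hL))) (blkFine L k (MP (paramsOf d L mT k hL))))
        (BlockNorm.ofBlocks (unitTorusGeo L k (MP (paramsOf d L mT k hL)))
          (fun i : Tor (fine (L ^ m * L ^ k) (MP (paramsOf d L mT k hL))) × Fin (d + 1) => blockOf (L ^ m * L ^ k) (MP (paramsOf d L mT k hL)) i.1))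
        (idef (pull (kingPrV L k m (MP (paramsOf d L mT k hL)))) (pull (kingPrV L k m (MP (paramsOf d L mT k hL))))
          (projO none ∘ₗ bgPair (gOp (MP (paramsOf d L mT k hL)) (L ^ m * L ^ k) a)
            (fun μ => symbOp (MP (paramsOf d L mT k hL)) (L ^ m * L ^ k) (sD (MP (paramsOf d L mT k hL)) (L ^ m * L ^ k) μ ((L ^ m * L ^ k : ℕ) : ℝ)) ∘ₗ
              gOp (MP (paramsOf d L mT k hL)) (L ^ m * L ^ k) a) c' a')
          (projO none ∘ₗ bgPair (gOp (MP (paramsOf d L mT k hL)) (L ^ k) a)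
            (fun μ => symbOp (MP (paramsOf d L mT k hL)) (L ^ k) (sD (MP (paramsOf d L mT k hL)) (L ^ k) μ ((L ^ k : ℕ) : ℝ)) ∘ₗ gOp (MP (paramsOf d L mT k hL)) (L ^ k) a)
            (blockAvg (kingPrV L k m (MP (paramsOf d L mT k hL))) c') (fun μ => blockAvg (kingPrV L k m (MP (paramsOf d L mT k hL))) (a' μ))))
        (fun y y' => B * (((L ^ k : ℕ) : ℝ) ^ (-(γ / 2)) + oa) * Real.exp (-(δ * tdistT (MP (paramsOf d L mT k hL)) y y'))) := by
  have hL2 : 2 ≤ L := by omega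
  have hL : Odd L ∧ 1 < L := ⟨hLodd, by omega⟩
  -- the `U ≡ 1` letters of record
  obtain ⟨δ₀, C, Cα, Cε, Cαε, hδ₀, hC, H110⟩ := ineq110_114_pair (d := d) hL ha
  obtain ⟨δ₁, D, hδ₁, hD, HDef⟩ := hasMaj_twoGridDefect (d := d) hLodd hL2 ha hγ0 hγ1
  -- rates and constants: `δ := min δ₀ δ₁`, `ρ = σ := δ∕2`; `C₂ := 2Ce^{δ₀}` (N-IIn); the smallness window `r₀`
  have hδ : 0 < min δ₀ δ₁ := lt_min hδ₀ hδ₁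
  have hσ : 0 < min δ₀ δ₁ / 2 := by positivity
  set cr : ℝ := B4Sect5Proof.latticeConst (d + 1) (min δ₀ δ₁ / 2) with hcr_def
  have hcr : 0 ≤ cr := B4Sect5Proof.latticeConst_nonneg (d + 1) hσ.le
  set C₂ : ℝ := 2 * (C * Real.exp δ₀) with hC₂_def
  have hC₂ : 0 ≤ C₂ := by positivity
  set W : ℝ := C * ((d : ℝ) + 2) * cr + (C + ((d : ℝ) + 1) * (C₂ + C)) * cr with hW_def
  have hW : 0 ≤ W := by positivity
  have hr₀ : 0 < (2 * W + 1)⁻¹ := by positivity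
  set r₀ : ℝ := (2 * W + 1)⁻¹ with hr₀_def
  refine ⟨min δ₀ δ₁ / 2, r₀,
    2 * (D * (1 + r₀ * ((d : ℝ) + 2) * (2 * C) * cr) + 2 * ((d : ℝ) + 1) * r₀ * C * (2 * C) * cr + ((d : ℝ) + 1) * ((C₂ + C) * r₀ * (2 * C)) * cr) +
      2 * (((d : ℝ) + 1) * (C * (2 * C)) * cr) + 1,
    hσ, hr₀, by positivity, ?_⟩
  intro mT k m hk hL' r hr hrr₀ rb hrb hrbr₀ oa hoa c' a' hc' ha' hb' hfa
  have hkpos : (0 : ℝ) < ((L ^ k : ℕ) : ℝ) := by positivity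
  have hn : 1 ≤ L ^ k := Nat.one_le_pow _ _ (by omega)
  have hn' : 1 ≤ L ^ m * L ^ k := Nat.one_le_iff_ne_zero.mpr (NeZero.ne _)
  have hmono : ∀ {F₁ F₂ : Type} [AddCommGroup F₁] [Module ℝ F₁] [AddCommGroup F₂] [Module ℝ F₂]
      {b₁ : BlockNorm (unitTorusGeo L k (MP (paramsOf d L mT k hL'))) F₁} {b₂ : BlockNorm (unitTorusGeo L k (MP (paramsOf d L mT k hL'))) F₂} {T : F₁ →ₗ[ℝ] F₂} {A t : ℝ},
      0 ≤ A → min δ₀ δ₁ ≤ t → HasMaj b₁ b₂ T (fun y y' => A * Real.exp (-(t * tdistT (MP (paramsOf d L mT k hL')) y y'))) →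
      HasMaj b₁ b₂ T (fun y y' => A * Real.exp (-(min δ₀ δ₁ * tdistT (MP (paramsOf d L mT k hL')) y y'))) :=
    fun hA ht h => h.mono fun y y' => mul_le_mul_of_nonneg_left (Real.exp_le_exp.mpr (by nlinarith [tdistT_nonneg (MP (paramsOf d L mT k hL')) y y'])) hA
  obtain ⟨Hc, Hf⟩ := H110 mT k m hk
  have hG := hmono hC.le (min_le_left _ _) (hasMaj_gOp_of_ineq (MP (paramsOf d L mT k hL')) k (L ^ k) a hn Hc hC.le)
  have hGD := fun μ : Fin (d + 1) => hmono hC.le (min_le_left _ _) (hasMaj_grad_of_ineq (MP (paramsOf d L mT k hL')) k (L ^ k) a hn Hc hC.le μ)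
  have hG' := hmono hC.le (min_le_left _ _) (hasMaj_gOp_of_ineq (MP (paramsOf d L mT k hL')) k (L ^ m * L ^ k) a hn' Hf hC.le)
  have hG'D := fun μ : Fin (d + 1) => hmono hC.le (min_le_left _ _) (hasMaj_grad_of_ineq (MP (paramsOf d L mT k hL')) k (L ^ m * L ^ k) a hn' Hf hC.le μ)
  have hG'grad := fun μ : Fin (d + 1) => hmono hC₂ (min_le_left _ _) (hasMaj_gGrad_of_ineq (L := L) (k := k) hn' Hf hC.le hδ₀.le μ)
  have hG'div := fun κ : Fin (d + 1) => hmono hC.le (min_le_left _ _) (hasMaj_gDivAdj_of_ineq (MP (paramsOf d L mT k hL')) k (L ^ m * L ^ k) a hn' Hf hC.le κ)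
  have hDk : 0 ≤ D * ((L ^ k : ℕ) : ℝ) ^ (-(γ / 2)) := mul_nonneg hD.le (Real.rpow_nonneg hkpos.le _)
  have hDG := hmono hDk (min_le_right _ _) (HDef mT k m hk hL')
  -- the two guards: `q₁ = Cr(d+2)c_r ≤ r₀W ≤ 1∕2`, `q₂ = (Cr + (d+1)(C₂r + Cr_b))c_r ≤ r₀W ≤ 1∕2`
  have h1 : r₀ * (2 * W + 1) = 1 := inv_mul_cancel₀ (by positivity)
  have hr₀W : r₀ * W ≤ 1 / 2 := by nlinarith [hr₀.le]
  have hq₁le : C * (r * ((d : ℝ) + 2)) * cr ≤ r₀ * W := by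
    calc C * (r * ((d : ℝ) + 2)) * cr = r * (C * ((d : ℝ) + 2) * cr) := by ring
      _ ≤ r₀ * (C * ((d : ℝ) + 2) * cr) := mul_le_mul_of_nonneg_right hrr₀ (by positivity)
      _ ≤ r₀ * W := mul_le_mul_of_nonneg_left (by rw [hW_def]; nlinarith [mul_nonneg (by positivity : (0 : ℝ) ≤ C + ((d : ℝ) + 1) * (C₂ + C)) hcr]) hr₀.le
  have hq₂le : (C * r + ((d : ℝ) + 1) * (C₂ * r + C * rb)) * cr ≤ r₀ * W := by
    have h : C * r + ((d : ℝ) + 1) * (C₂ * r + C * rb) ≤ r₀ * (C + ((d : ℝ) + 1) * (C₂ + C)) := by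
      nlinarith [mul_le_mul_of_nonneg_left hrr₀ hC.le, mul_le_mul_of_nonneg_left hrr₀ hC₂, mul_le_mul_of_nonneg_left hrbr₀ hC.le,
        mul_nonneg (by positivity : (0 : ℝ) ≤ (d : ℝ) + 1) hC₂]
    calc (C * r + ((d : ℝ) + 1) * (C₂ * r + C * rb)) * cr ≤ r₀ * (C + ((d : ℝ) + 1) * (C₂ + C)) * cr := mul_le_mul_of_nonneg_right h hcr
      _ ≤ r₀ * W := by rw [hW_def]; nlinarith [mul_nonneg (by positivity : (0 : ℝ) ≤ C * ((d : ℝ) + 2)) hcr, hr₀.le]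
  have hq : C * (r * ((d : ℝ) + 2)) * cr < 1 := by linarith
  have hqK : (C * r + ((d : ℝ) + 1) * (C₂ * r + C * rb)) * cr < 1 := by linarith
  have hq₁0 : 0 ≤ (1 - C * (r * ((d : ℝ) + 2)) * cr)⁻¹ := inv_nonneg.mpr (by linarith)
  have hq₁2 : (1 - C * (r * ((d : ℝ) + 2)) * cr)⁻¹ ≤ 2 := by
    calc (1 - C * (r * ((d : ℝ) + 2)) * cr)⁻¹ ≤ (1 / 2)⁻¹ := inv_anti₀ (by norm_num) (by linarith)
      _ = 2 := by norm_num
  have hq₂0 : 0 ≤ (1 - (C * r + ((d : ℝ) + 1) * (C₂ * r + C * rb)) * cr)⁻¹ := inv_nonneg.mpr (by linarith)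
  have hq₂2 : (1 - (C * r + ((d : ℝ) + 1) * (C₂ * r + C * rb)) * cr)⁻¹ ≤ 2 := by
    calc (1 - (C * r + ((d : ℝ) + 1) * (C₂ * r + C * rb)) * cr)⁻¹ ≤ (1 / 2)⁻¹ := inv_anti₀ (by norm_num) (by linarith)
      _ = 2 := by norm_num
  -- II-C
  have key := hasMaj_idef_bgPairValue_of_letters (MP (paramsOf d L mT k hL')) k m hσ.le hcr (rowSum_unitTorusGeo L k (MP (paramsOf d L mT k hL')) hσ)
    (ρ := min δ₀ δ₁ / 2) (δ := min δ₀ δ₁) hσ.le (by linarith) hC.le hC.le hC₂ hDk hr hrb hoa hG hGD hG' hG'D hG'grad hG'div hDG hc' ha' hb' hfa hq hqK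
  -- `L^{−k} ≤ (L^k)^{−γ∕2}`
  have hrate : (((L ^ k : ℕ) : ℝ))⁻¹ ≤ ((L ^ k : ℕ) : ℝ) ^ (-(γ / 2)) := by
    rw [← Real.rpow_neg_one]
    exact Real.rpow_le_rpow_of_exponent_le (by exact_mod_cast hn) (by linarith)
  have hθ := Real.rpow_nonneg hkpos.le (-(γ / 2))
  have hbd := firstOrder_const_bound (t := (d : ℝ)) hD.le hC.le hC₂ hcr hr hrr₀ hrb hrbr₀ hoa hθ (inv_nonneg.mpr hkpos.le) hrate (by positivity) hq₁0 hq₁2 hq₂0 hq₂2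
  refine key.mono fun y y' => ?_
  have hE := Real.exp_nonneg (-(min δ₀ δ₁ / 2 * tdistT (MP (paramsOf d L mT k hL')) y y'))
  exact mul_le_mul_of_nonneg_right hbd hE

end Balaban

end Summit.QuantumFields.YangMills.BalabanUVNodes.N15.TwoGrid

end
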